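import Summits.QuantumFields.BalabanUV.Beta.D1BFx.MixedVarPackedHess
import Summits.QuantumFields.BalabanUV.Beta.FP.SecondVarPolarisation

/-!
# `BalabanUV.Beta.FP.GradedPackedHess` — road «FP» for binder row D1, ROUTE T, junction (J-b) «FUNCTIONAL → KERNEL», SECOND HALF (memo `N2B-DESIGN.md` §30 (30c)):
# **THE TWO-POINT KERNEL OF A GRADED ZERO-SLICE BORDERED SYSTEM IN LEG CURRENCY** — the graded (R-FP-54′) twin of road BF-x's TA4
# `MixedVarPackedHess.mixedVar_kkt_fromRows_zero`: only the packed `(ν ⊕ μ)` blocks of the inverse meet the jets, and the kernel is `2·hessT` of that packed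
# leg against the PACKED GRADED vertices `[[K, −Qᵀ],[Q, 0]]`

WHAT.  After `SecondVarKernelLaw` (OWNER #20) the (STEP) door for every direction is an identity of three torus kernels
`K_X(a,b) = mixedVar X₀ J_X(a) J_X(b) J_X(a,b)` whose first jets are the GRADED zero-slice bordered matrices `[[K_a, −[Q_a;0]ᵀ],[[Q_a;0], 0]]` on the three sorts
`ν ⊕ (μ ⊕ ρ)` (fields, coarse multipliers, slice multipliers) and whose second jets are `kkt K_ab [Q_ab;0]`.  This file reads such a kernel in LEG currency:
* §1 `signTwist_zeroSlice_apply_map ∕ _apply_inr_inr_right ∕ _apply_inr_inr_left` — the graded jet has ZERO comb rows and columns and its packed block is the packed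
  graded vertex `[[K, −Qᵀ],[Q, 0]]` (written `fromBlocks K (−Qᵀ) Q 0`, no definition; `= kkt K Q · diag(1,−1)` by `ColourDoublingKkt.kkt_signTwist`);
* §2 `submatrix_mul_signTwist_zeroSlice ∕ mul_signTwist_zeroSlice_apply_inr_inr ∕ trace_mul_signTwist_mul_mul_signTwist_zeroSlice` — only the packed blocks of the
  two legs meet the two graded jets (TA4's `trace_eq_trace_submatrix_of_comb_col_zero ∕ submatrix_mul_of_comb_col_zero` BY NAME);
* §3 **`mixedVar_signTwist_fromRows_zero`**: `mixedVar M [[Kₛ,−[Qₛ;0]ᵀ],[[Qₛ;0],0]] [[Kₜ,…]] (kkt Kₛₜ [Qₛₜ;0]) = 2·hessT (M⁻¹.submatrix e e) [[Kₛ,−Qₛᵀ],[Qₛ,0]] [[Kₜ,−Qₜᵀ],[Qₜ,0]]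
  (kkt Kₛₜ Qₛₜ)`, `e = Sum.map id Sum.inl` — no invertibility hypothesis; `_of_mul_eq_one ∕ _left` leg sockets (`M·X = 1 ⇒` the packed blocks of `X` are the leg).
`hessT L V V′ W = ½·(tr(L·W) − tr(L·V·(L·V′)))` (BF-x TA4) is the finite-index twin of `ExpKernelCalculus.hessKer`: ONE leg `L` on the packed index (the END's
`KInvStep Lc j` lives on `Idx M (Fib d)` = sites × (fields ⊕ multipliers) — exactly the packed sorts), GRADED vertices (the dictionary's first-order tables have
antisymmetric borders — leaf-05's `RelInvPeriodisedChart.perF_inl_inr_eq_neg_of_anti` —, which is WHY the door is read graded, R-FP-54′), symmetric second vertex.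
So after §3 each of the door's three torus kernels is `2·hessT (packed leg) (packed graded vertex_a) (packed graded vertex_b) (packed second vertex_ab)` — the
shape (B2) names against `perF`-periodised lattice kernels (memo §30 (30d)).  The road's `SecondVarPolarisation.mixedVar` and BF-x's `SliceTransferJetsMixed.mixedVar`
are the same expression; §3 is stated for the ROAD's (the one `KktPolarisation` ∕ `SecondVarKernelLaw` speak).  [folklore] throughout; no `def`, no `def … : Prop`,
nothing cited, 0 sorry; 0 estimates.

HONEST DEPENDENCY (page 1, mandatory): continuum YM on T⁴ ⇐ BetaPertH ∧ nine spine estimates (0/9 proved); BetaPertH ⇐ (D1) ∧ (D4) ∧ CAP+tail;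
G-an2-4 gates asym, D1 and NE2/3/4.  HONEST FRAMING (cell contract, verbatim): «discharging `BetaPertH` makes Bałaban's UV stability UNCONDITIONAL —
a real constructive-QFT result; it is NOT the continuum limit and NOT the Clay problem.»  ABSOLUTE RULE (cell charter, verbatim): «No internally-minted
statement may enter as a cited fact. Every hypothesis is either kernel-proved in this package or a verbatim quotation of a PUBLISHED theorem with page
reference. The manuscript(s) under audit are NOT citable for their own disputed steps — they are the thing under adjudication; programme-internal
(2001/route/tribunal) claims are never citable.»  Nothing of Bałaban's asserted; 0∕4 row-D1 binders; NOT (T-ID), NOT SDF, NOT D1, NOT BetaPertH, NOT continuum,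
NOT Clay.  Road «FP» OWNER, b2b-balaban-beta-d1-p3 gen 21, 2026-08-22.  No existing file touched.
-/

noncomputable section

open scoped BigOperators Matrix

namespace Summit.QuantumFields.BalabanUV.Beta.FP.GradedPackedHess

open Matrix
open Literature.MathematicalPhysics.QuantumFieldTheory.Balaban1983to89.Beta.Composition (kkt)
open Summit.QuantumFields.BalabanUV.Beta.FP.SecondVarPolarisation (mixedVar)
open Summit.QuantumFields.BalabanUV.Beta.D1BFx.MixedVarPackedHess (hessT two_mul_hessT sum_three_eq_sum_map_add
  trace_eq_trace_submatrix_of_comb_col_zero submatrix_mul_of_comb_col_zero trace_mul_kkt_fromRows_zero)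

/-! ## §1 The graded zero-slice bordered jet: zero comb rows ∕ columns, packed block -/

section Pack

variable {ν μ ρ : Type*}

/-- [folklore] The graded jet `[[K, −[Q;0]ᵀ],[[Q;0], 0]]` read on two packed indices is the packed graded vertex `[[K, −Qᵀ],[Q, 0]]`. -/
theorem signTwist_zeroSlice_apply_map (K : Matrix ν ν ℝ) (Q : Matrix μ ν ℝ) (i j : ν ⊕ μ) :
    (fromBlocks K (-(fromRows Q (0 : Matrix ρ ν ℝ))ᵀ) (fromRows Q (0 : Matrix ρ ν ℝ)) 0) (Sum.map id Sum.inl i) (Sum.map id Sum.inl j)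
      = (fromBlocks K (-Qᵀ) Q 0) i j := by
  rcases i with i | i <;> rcases j with j | j <;> rfl

/-- [folklore] The graded jet has ZERO comb columns. -/
theorem signTwist_zeroSlice_apply_inr_inr_right (K : Matrix ν ν ℝ) (Q : Matrix μ ν ℝ) (a : ν ⊕ (μ ⊕ ρ)) (r : ρ) :
    (fromBlocks K (-(fromRows Q (0 : Matrix ρ ν ℝ))ᵀ) (fromRows Q (0 : Matrix ρ ν ℝ)) 0) a (Sum.inr (Sum.inr r)) = 0 := by
  rcases a with a | a | a
  · simp [Matrix.fromBlocks_apply₁₂]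
  · rfl
  · rfl

/-- [folklore] The graded jet has ZERO comb rows. -/
theorem signTwist_zeroSlice_apply_inr_inr_left (K : Matrix ν ν ℝ) (Q : Matrix μ ν ℝ) (r : ρ) (b : ν ⊕ (μ ⊕ ρ)) :
    (fromBlocks K (-(fromRows Q (0 : Matrix ρ ν ℝ))ᵀ) (fromRows Q (0 : Matrix ρ ν ℝ)) 0) (Sum.inr (Sum.inr r)) b = 0 := by
  rcases b with b | b | b <;> rfl

end Pack

/-! ## §2 Only the packed blocks of the legs meet the graded jets -/

section Meet

variable {ν μ ρ : Type*} [Fintype ν] [Fintype μ] [Fintype ρ]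

/-- [folklore] **ONLY THE PACKED COLUMNS OF THE LEG MEET THE GRADED JET**: `(X · [[K,−[Q;0]ᵀ],[[Q;0],0]]).submatrix f e = X.submatrix f e · [[K,−Qᵀ],[Q,0]]`. -/
theorem submatrix_mul_signTwist_zeroSlice {l : Type*} (X : Matrix (ν ⊕ (μ ⊕ ρ)) (ν ⊕ (μ ⊕ ρ)) ℝ) (K : Matrix ν ν ℝ) (Q : Matrix μ ν ℝ)
    (f : l → ν ⊕ (μ ⊕ ρ)) :
    (X * fromBlocks K (-(fromRows Q (0 : Matrix ρ ν ℝ))ᵀ) (fromRows Q (0 : Matrix ρ ν ℝ)) 0).submatrix f (Sum.map id Sum.inl)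
      = X.submatrix f (Sum.map id Sum.inl) * fromBlocks K (-Qᵀ) Q 0 := by
  ext a j
  simp only [Matrix.submatrix_apply, Matrix.mul_apply]
  rw [sum_three_eq_sum_map_add]
  simp only [signTwist_zeroSlice_apply_map, signTwist_zeroSlice_apply_inr_inr_left, mul_zero, Finset.sum_const_zero, add_zero]

/-- [folklore] The comb columns of `X · [[K,−[Q;0]ᵀ],[[Q;0],0]]` vanish. -/
theorem mul_signTwist_zeroSlice_apply_inr_inr (X : Matrix (ν ⊕ (μ ⊕ ρ)) (ν ⊕ (μ ⊕ ρ)) ℝ) (K : Matrix ν ν ℝ) (Q : Matrix μ ν ℝ)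
    (a : ν ⊕ (μ ⊕ ρ)) (r : ρ) :
    (X * fromBlocks K (-(fromRows Q (0 : Matrix ρ ν ℝ))ᵀ) (fromRows Q (0 : Matrix ρ ν ℝ)) 0) a (Sum.inr (Sum.inr r)) = 0 := by
  simp only [Matrix.mul_apply, signTwist_zeroSlice_apply_inr_inr_right, mul_zero, Finset.sum_const_zero]

/-- [folklore] **GRADED BUBBLE READ-OUT**: `tr(X·Jₛ^ext·(Y·Jₜ^ext)) = tr(X.submatrix e e·[[Kₛ,−Qₛᵀ],[Qₛ,0]]·(Y.submatrix e e·[[Kₜ,−Qₜᵀ],[Qₜ,0]]))` — only the packed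
blocks of the two legs enter. -/
theorem trace_mul_signTwist_mul_mul_signTwist_zeroSlice (X Y : Matrix (ν ⊕ (μ ⊕ ρ)) (ν ⊕ (μ ⊕ ρ)) ℝ) (Kₛ Kₜ : Matrix ν ν ℝ) (Qₛ Qₜ : Matrix μ ν ℝ) :
    (X * fromBlocks Kₛ (-(fromRows Qₛ (0 : Matrix ρ ν ℝ))ᵀ) (fromRows Qₛ (0 : Matrix ρ ν ℝ)) 0
        * (Y * fromBlocks Kₜ (-(fromRows Qₜ (0 : Matrix ρ ν ℝ))ᵀ) (fromRows Qₜ (0 : Matrix ρ ν ℝ)) 0)).trace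
      = (X.submatrix (Sum.map id Sum.inl) (Sum.map id Sum.inl) * fromBlocks Kₛ (-Qₛᵀ) Qₛ 0
          * (Y.submatrix (Sum.map id Sum.inl) (Sum.map id Sum.inl) * fromBlocks Kₜ (-Qₜᵀ) Qₜ 0)).trace := by
  have h₂ : ∀ a r, (X * fromBlocks Kₛ (-(fromRows Qₛ (0 : Matrix ρ ν ℝ))ᵀ) (fromRows Qₛ (0 : Matrix ρ ν ℝ)) 0
      * (Y * fromBlocks Kₜ (-(fromRows Qₜ (0 : Matrix ρ ν ℝ))ᵀ) (fromRows Qₜ (0 : Matrix ρ ν ℝ)) 0)) a (Sum.inr (Sum.inr r)) = 0 := by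
    intro a r
    simp only [Matrix.mul_apply (M := X * fromBlocks Kₛ (-(fromRows Qₛ (0 : Matrix ρ ν ℝ))ᵀ) (fromRows Qₛ (0 : Matrix ρ ν ℝ)) 0),
      mul_signTwist_zeroSlice_apply_inr_inr Y Kₜ Qₜ, mul_zero, Finset.sum_const_zero]
  rw [trace_eq_trace_submatrix_of_comb_col_zero h₂,
    submatrix_mul_of_comb_col_zero (mul_signTwist_zeroSlice_apply_inr_inr X Kₛ Qₛ), submatrix_mul_signTwist_zeroSlice,
    submatrix_mul_signTwist_zeroSlice]

end Meet

/-! ## §3 The graded torus kernel = `2·hessT` on the packed leg against packed graded vertices -/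

section Main

variable {ν μ ρ : Type*} [Fintype ν] [Fintype μ] [Fintype ρ] [DecidableEq ν] [DecidableEq μ] [DecidableEq ρ]

/-- [folklore] **THE MIXED ONE-LOOP FUNCTIONAL OF A GRADED ZERO-SLICE BORDERED SYSTEM IS `2·hessT` OF THE PACKED BLOCKS OF ITS INVERSE AGAINST THE PACKED GRADED
VERTICES.**  For ANY matrix `M` on the three sorts `ν ⊕ (μ ⊕ ρ)`, graded first jets `[[Kₛ, −[Qₛ;0]ᵀ],[[Qₛ;0], 0]]`, `[[Kₜ, −[Qₜ;0]ᵀ],[[Qₜ;0], 0]]` and second jet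
`kkt Kₛₜ [Qₛₜ;0]`:
`mixedVar M Jₛ^ext Jₜ^ext Jₛₜ^ext = 2·hessT (M⁻¹.submatrix e e) [[Kₛ,−Qₛᵀ],[Qₛ,0]] [[Kₜ,−Qₜᵀ],[Qₜ,0]] (kkt Kₛₜ Qₛₜ)`, `e = Sum.map id Sum.inl` — only the `(ν ⊕ μ)` blocks of
`M⁻¹` (the packed fields ⊕ coarse-multipliers LEG) enter; no invertibility hypothesis is needed for the identity. -/
theorem mixedVar_signTwist_fromRows_zero (M : Matrix (ν ⊕ (μ ⊕ ρ)) (ν ⊕ (μ ⊕ ρ)) ℝ) (Kₛ Kₜ Kₛₜ : Matrix ν ν ℝ) (Qₛ Qₜ Qₛₜ : Matrix μ ν ℝ) :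
    mixedVar M (fromBlocks Kₛ (-(fromRows Qₛ (0 : Matrix ρ ν ℝ))ᵀ) (fromRows Qₛ (0 : Matrix ρ ν ℝ)) 0)
        (fromBlocks Kₜ (-(fromRows Qₜ (0 : Matrix ρ ν ℝ))ᵀ) (fromRows Qₜ (0 : Matrix ρ ν ℝ)) 0)
        (kkt Kₛₜ (fromRows Qₛₜ (0 : Matrix ρ ν ℝ)))
      = 2 * hessT (M⁻¹.submatrix (Sum.map id Sum.inl) (Sum.map id Sum.inl)) (fromBlocks Kₛ (-Qₛᵀ) Qₛ 0) (fromBlocks Kₜ (-Qₜᵀ) Qₜ 0) (kkt Kₛₜ Qₛₜ) := by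
  rw [two_mul_hessT, mixedVar, trace_mul_kkt_fromRows_zero, trace_mul_signTwist_mul_mul_signTwist_zeroSlice]

/-- [folklore] **LEG SOCKET**: if `M · X = 1` then the packed blocks of `X` are the leg:
`mixedVar M Jₛ^ext Jₜ^ext Jₛₜ^ext = 2·hessT (X.submatrix e e) [[Kₛ,−Qₛᵀ],[Qₛ,0]] [[Kₜ,−Qₜᵀ],[Qₜ,0]] (kkt Kₛₜ Qₛₜ)`. -/
theorem mixedVar_signTwist_fromRows_zero_of_mul_eq_one {M X : Matrix (ν ⊕ (μ ⊕ ρ)) (ν ⊕ (μ ⊕ ρ)) ℝ} (h : M * X = 1)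
    (Kₛ Kₜ Kₛₜ : Matrix ν ν ℝ) (Qₛ Qₜ Qₛₜ : Matrix μ ν ℝ) :
    mixedVar M (fromBlocks Kₛ (-(fromRows Qₛ (0 : Matrix ρ ν ℝ))ᵀ) (fromRows Qₛ (0 : Matrix ρ ν ℝ)) 0)
        (fromBlocks Kₜ (-(fromRows Qₜ (0 : Matrix ρ ν ℝ))ᵀ) (fromRows Qₜ (0 : Matrix ρ ν ℝ)) 0)
        (kkt Kₛₜ (fromRows Qₛₜ (0 : Matrix ρ ν ℝ)))
      = 2 * hessT (X.submatrix (Sum.map id Sum.inl) (Sum.map id Sum.inl)) (fromBlocks Kₛ (-Qₛᵀ) Qₛ 0) (fromBlocks Kₜ (-Qₜᵀ) Qₜ 0) (kkt Kₛₜ Qₛₜ) := by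
  rw [mixedVar_signTwist_fromRows_zero, Matrix.inv_eq_right_inv h]

/-- [folklore] The same socket with a LEFT inverse `X · M = 1`. -/
theorem mixedVar_signTwist_fromRows_zero_of_mul_eq_one_left {M X : Matrix (ν ⊕ (μ ⊕ ρ)) (ν ⊕ (μ ⊕ ρ)) ℝ} (h : X * M = 1)
    (Kₛ Kₜ Kₛₜ : Matrix ν ν ℝ) (Qₛ Qₜ Qₛₜ : Matrix μ ν ℝ) :
    mixedVar M (fromBlocks Kₛ (-(fromRows Qₛ (0 : Matrix ρ ν ℝ))ᵀ) (fromRows Qₛ (0 : Matrix ρ ν ℝ)) 0)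
        (fromBlocks Kₜ (-(fromRows Qₜ (0 : Matrix ρ ν ℝ))ᵀ) (fromRows Qₜ (0 : Matrix ρ ν ℝ)) 0)
        (kkt Kₛₜ (fromRows Qₛₜ (0 : Matrix ρ ν ℝ)))
      = 2 * hessT (X.submatrix (Sum.map id Sum.inl) (Sum.map id Sum.inl)) (fromBlocks Kₛ (-Qₛᵀ) Qₛ 0) (fromBlocks Kₜ (-Qₜᵀ) Qₜ 0) (kkt Kₛₜ Qₛₜ) := by
  rw [mixedVar_signTwist_fromRows_zero, Matrix.inv_eq_left_inv h]

end Main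

/-! ## §4 The packed leg against a packed GRADED vertex, in blocks -/

section Blocks

variable {ν μ : Type*} [Fintype ν] [Fintype μ]

/-- [folklore] **THE PACKED LEG AGAINST A PACKED GRADED VERTEX, IN BLOCKS**: `fromBlocks Γ H H′ S · [[K, −Qᵀ],[Q, 0]] = fromBlocks (Γ·K + H·Q) (−Γ·Qᵀ) (H′·K + S·Q) (−H′·Qᵀ)`
— the graded twin of TA4's `fromBlocks_mul_kkt` (the border column enters with a sign). -/
theorem fromBlocks_mul_signTwist (Γ : Matrix ν ν ℝ) (H : Matrix ν μ ℝ) (H' : Matrix μ ν ℝ) (S : Matrix μ μ ℝ) (K : Matrix ν ν ℝ) (Q : Matrix μ ν ℝ) :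
    fromBlocks Γ H H' S * fromBlocks K (-Qᵀ) Q 0 = fromBlocks (Γ * K + H * Q) (-(Γ * Qᵀ)) (H' * K + S * Q) (-(H' * Qᵀ)) := by
  rw [Matrix.fromBlocks_multiply]
  simp only [Matrix.mul_zero, add_zero, Matrix.mul_neg]

/-- [folklore] **THE GRADED PACKED BUBBLE IN BLOCKS**: `tr((fromBlocks Γ H H′ S · [[Kₛ,−Qₛᵀ],[Qₛ,0]]) · (fromBlocks Γ H H′ S · [[Kₜ,−Qₜᵀ],[Qₜ,0]]))` = the field–field
channel `tr((ΓKₛ + HQₛ)(ΓKₜ + HQₜ))` MINUS the two field–multiplier cross channels `tr(ΓQₛᵀ(H′Kₜ + SQₜ)) + tr((H′Kₛ + SQₛ)ΓQₜᵀ)` PLUS the multiplier channel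
`tr(H′QₛᵀH′Qₜᵀ)` — relative to TA4's un-graded `trace_bubble_fromBlocks_kkt` exactly the CROSS channels flip sign (each carries one graded border). -/
theorem trace_bubble_fromBlocks_signTwist (Γ : Matrix ν ν ℝ) (H : Matrix ν μ ℝ) (H' : Matrix μ ν ℝ) (S : Matrix μ μ ℝ) (Kₛ Kₜ : Matrix ν ν ℝ)
    (Qₛ Qₜ : Matrix μ ν ℝ) :
    (fromBlocks Γ H H' S * fromBlocks Kₛ (-Qₛᵀ) Qₛ 0 * (fromBlocks Γ H H' S * fromBlocks Kₜ (-Qₜᵀ) Qₜ 0)).trace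
      = ((Γ * Kₛ + H * Qₛ) * (Γ * Kₜ + H * Qₜ)).trace - (Γ * Qₛᵀ * (H' * Kₜ + S * Qₜ)).trace
        - ((H' * Kₛ + S * Qₛ) * (Γ * Qₜᵀ)).trace + (H' * Qₛᵀ * (H' * Qₜᵀ)).trace := by
  rw [fromBlocks_mul_signTwist, fromBlocks_mul_signTwist, Matrix.fromBlocks_multiply]
  simp only [Matrix.trace, Matrix.diag_apply, Fintype.sum_sum_type, Matrix.fromBlocks_apply₁₁, Matrix.fromBlocks_apply₂₂,
    Matrix.add_apply, Matrix.neg_mul, Matrix.mul_neg, neg_neg, Matrix.neg_apply, Finset.sum_add_distrib, Finset.sum_neg_distrib]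
  ring

end Blocks

end Summit.QuantumFields.BalabanUV.Beta.FP.GradedPackedHess

end
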